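import Mathlib
import HarnessLib
import Literature.Analysis.PDE.DivFormLiouville
import Summits.NavierStokesRegularity.NavierStokesRegularity.Theorems.PoloidalWindowDoorPoloidalWindowRigidityDivFormHarnack

/-!
# Route `PoloidalWindowDoor`, crux K2 (stmt-NavierStokesRegularity-19708) — task H5, step M4b: scaling, HARNACK ON ALL BALLS,
# and the LIOUVILLE THEOREM for `div(a∇u) = 0` in dimension `n ≥ 3` (towards `divFormLiouville_holds`)

Seat ns-poloidal-K2-p3 g2 (`ledger fact claim` #1 on `Literature.Analysis.PDE.divFormLiouville`).  Moser 1961, Thm 1 and its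
Liouville corollary (Jost, *PDE*, Thm 14.2.3), `n ≥ 3`:

* `weak_comp_affine` — the class of entire `C¹` weak solutions is invariant under `w ↦ w(x₀ + R·)` (coefficients
  `a(x₀ + R·)`, same ellipticity constants);
* `harnack_ball` — `w(x) ≤ C_H w(y)` for `x, y ∈ B̄(x₀,R)`, every `x₀`, `R > 0`, `C_H = C_H(n,λ,Λ)` (from M4a by scaling);
* `liouville_of_three_le` — a bounded entire `C¹` weak solution is constant (`n ≥ 3`): apply Harnack to
  `w_ε = (u − inf u + ε)/ε ≥ 1` and let `R → ∞`, `ε → 0`.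

WHAT THIS IS NOT: the dimensions `n ≤ 2` (M4c, by lifting to `ℝ^{n+3}`) and the Literature-side discharge file remain.
-/

noncomputable section

open MeasureTheory Set Function Filter Topology Metric Module
open scoped Matrix ENNReal NNReal

-- the summit and its single sub-problem share the name (CONVENTIONS §1), as in every Theorems file
set_option linter.dupNamespace false

namespace Summit.NavierStokesRegularity.NavierStokesRegularity.Theorems.PoloidalWindowDoorPoloidalWindowRigidityDivFormLiouvilleHigh

open Summit.NavierStokesRegularity.NavierStokesRegularity.Theorems.PoloidalWindowDoorPoloidalWindowRigidityDivFormHarnack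

variable {n : ℕ} {a : EuclideanSpace ℝ (Fin n) → Matrix (Fin n) (Fin n) ℝ} {lam Λ : ℝ}
  {w : EuclideanSpace ℝ (Fin n) → ℝ}

/-! ### Scaling and translation -/

/-- **Affine invariance of the class.**  If `w` is an entire `C¹` weak solution for the coefficients `a`, then
`y ↦ w(x₀ + R y)` (`R ≠ 0`) is one for `y ↦ a(x₀ + R y)`. -/
theorem weak_comp_affine (hw : ContDiff ℝ 1 w)
    (hweak : ∀ η : EuclideanSpace ℝ (Fin n) → ℝ, ContDiff ℝ 1 η → HasCompactSupport η →
      ∫ y, ∑ i, ∑ j, a y i j * fderiv ℝ w y (EuclideanSpace.single i 1) *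
        fderiv ℝ η y (EuclideanSpace.single j 1) = 0)
    (x₀ : EuclideanSpace ℝ (Fin n)) {R : ℝ} (hR : R ≠ 0) :
    ∀ η : EuclideanSpace ℝ (Fin n) → ℝ, ContDiff ℝ 1 η → HasCompactSupport η →
      ∫ y, ∑ i, ∑ j, a (x₀ + R • y) i j * fderiv ℝ (fun y => w (x₀ + R • y)) y (EuclideanSpace.single i 1) *
        fderiv ℝ η y (EuclideanSpace.single j 1) = 0 := by
  intro η hη hηc
  -- the affine map and its inverse
  set T : EuclideanSpace ℝ (Fin n) → EuclideanSpace ℝ (Fin n) := fun y => x₀ + R • y with hT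
  set S : EuclideanSpace ℝ (Fin n) → EuclideanSpace ℝ (Fin n) := fun z => R⁻¹ • (-x₀ + z) with hS
  have hST : ∀ y, S (T y) = y := fun y => by
    simp only [hS, hT, neg_add_cancel_left, smul_smul, inv_mul_cancel₀ hR, one_smul]
  have hTd : ∀ y, HasFDerivAt T (R • ContinuousLinearMap.id ℝ _) y := fun y => by
    have h := ((ContinuousLinearMap.id ℝ (EuclideanSpace ℝ (Fin n))).hasFDerivAt (x := y)).const_smul R
    simpa [hT] using h.const_add x₀
  -- the transported test function `η̃ = η ∘ S`
  set ηt : EuclideanSpace ℝ (Fin n) → ℝ := fun z => η (S z) with hηt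
  have hSC : ContDiff ℝ 1 S := (contDiff_const.add contDiff_id).const_smul R⁻¹
  have hTC : ContDiff ℝ 1 T := contDiff_const.add (contDiff_id.const_smul R)
  have hηtC : ContDiff ℝ 1 ηt := hη.comp hSC
  have hηtc : HasCompactSupport ηt := by
    have hφ : HasCompactSupport (η ∘ ((Homeomorph.addLeft (-x₀)).trans (Homeomorph.smulOfNeZero R⁻¹ (inv_ne_zero hR)))) :=
      hηc.comp_homeomorph _
    have heq : ηt = η ∘ ((Homeomorph.addLeft (-x₀)).trans (Homeomorph.smulOfNeZero R⁻¹ (inv_ne_zero hR))) := by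
      funext z
      simp [hηt, hS, Homeomorph.trans_apply]
    rw [heq]
    exact hφ
  -- chain rules: `∂ᵢ(w ∘ T)(y) = R ∂ᵢw(T y)`, `∂ⱼη(y) = ∂ⱼ(η̃ ∘ T)(y) = R ∂ⱼη̃(T y)`
  have hdw : ∀ y i, fderiv ℝ (fun y => w (x₀ + R • y)) y (EuclideanSpace.single i 1) =
      R * fderiv ℝ w (T y) (EuclideanSpace.single i 1) := by
    intro y i
    have h := (((hw.differentiable one_ne_zero) (T y)).hasFDerivAt).comp y (hTd y)
    rw [show (fun y => w (x₀ + R • y)) = w ∘ T from rfl, h.fderiv]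
    simp
  have hdη : ∀ y j, fderiv ℝ η y (EuclideanSpace.single j 1) = R * fderiv ℝ ηt (T y) (EuclideanSpace.single j 1) := by
    intro y j
    have hηeq : η = ηt ∘ T := by funext y'; simp [hηt, hST]
    have h := (((hηtC.differentiable one_ne_zero) (T y)).hasFDerivAt).comp y (hTd y)
    rw [hηeq, h.fderiv]
    simp
  -- the integrand is `R² F(T y)` with `F` the integrand of the weak form for `η̃`
  set F : EuclideanSpace ℝ (Fin n) → ℝ := fun z => ∑ i, ∑ j, a z i j * fderiv ℝ w z (EuclideanSpace.single i 1) *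
    fderiv ℝ ηt z (EuclideanSpace.single j 1) with hF
  have hpt : ∀ y, ∑ i, ∑ j, a (x₀ + R • y) i j * fderiv ℝ (fun y => w (x₀ + R • y)) y (EuclideanSpace.single i 1) *
      fderiv ℝ η y (EuclideanSpace.single j 1) = R ^ 2 * F (T y) := by
    intro y
    simp only [hF, hdw, hdη, Finset.mul_sum]
    refine Finset.sum_congr rfl fun i _ => Finset.sum_congr rfl fun j _ => ?_
    simp only [hT]; ring
  simp_rw [hpt]
  rw [integral_const_mul]
  have hF0 : ∫ z, F z = 0 := hweak ηt hηtC hηtc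
  have hcomp : ∫ y, F (T y) = |(R ^ finrank ℝ (EuclideanSpace ℝ (Fin n)))⁻¹| * ∫ z, F z := by
    have h1 : ∫ y, F (T y) = ∫ y, (fun z => F (x₀ + z)) (R • y) := by simp only [hT]
    have h2 : ∫ y, (fun z => F (x₀ + z)) (R • y) =
        |(R ^ finrank ℝ (EuclideanSpace ℝ (Fin n)))⁻¹| • ∫ z, (fun z => F (x₀ + z)) z :=
      by
        have h := Measure.integral_comp_smul (μ := (volume : Measure (EuclideanSpace ℝ (Fin n))))
          (fun z => F (x₀ + z)) R
        convert h using 3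
    have h3 : ∫ z, (fun z => F (x₀ + z)) z = ∫ z, F z := integral_add_left_eq_self F x₀
    rw [h1, h2, h3, smul_eq_mul]
  rw [hcomp, hF0, mul_zero, mul_zero]


/-! ### Harnack on every ball -/

/-- **MOSER'S HARNACK INEQUALITY** (Moser 1961, Thm 1), `n ≥ 3`: there is `C_H = C_H(n,λ,Λ) ≥ 0` such that every entire
`C¹` weak solution `w ≥ 1` of `div(a∇w) = 0` satisfies `w(x) ≤ C_H w(y)` for all `x, y ∈ B̄(x₀,R)`, every `x₀`, `R > 0`. -/
theorem harnack_ball (hn : 3 ≤ n) {lam : ℝ} (hlam : 0 < lam) (Λ : ℝ) :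
    ∃ C_H : ℝ, 0 ≤ C_H ∧ ∀ (a : EuclideanSpace ℝ (Fin n) → Matrix (Fin n) (Fin n) ℝ),
      (∀ i j, Measurable fun y => a y i j) → (∀ y, (a y).IsSymm) →
      (∀ y (ξ : Fin n → ℝ), lam * (ξ ⬝ᵥ ξ) ≤ ξ ⬝ᵥ (a y *ᵥ ξ)) → (∀ y i j, |a y i j| ≤ Λ) →
      ∀ (w : EuclideanSpace ℝ (Fin n) → ℝ), ContDiff ℝ 1 w → (∀ y, 1 ≤ w y) →
        (∀ η : EuclideanSpace ℝ (Fin n) → ℝ, ContDiff ℝ 1 η → HasCompactSupport η →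
          ∫ y, ∑ i, ∑ j, a y i j * fderiv ℝ w y (EuclideanSpace.single i 1) *
            fderiv ℝ η y (EuclideanSpace.single j 1) = 0) →
        ∀ (x₀ : EuclideanSpace ℝ (Fin n)) (R : ℝ), 0 < R →
          ∀ x ∈ closedBall x₀ R, ∀ y ∈ closedBall x₀ R, w x ≤ C_H * w y := by
  obtain ⟨C_H, hC0, hH⟩ := harnack_unit hn hlam Λ
  refine ⟨C_H, hC0, fun a hmeas hsymm hell hbd w hw hw1 hweak x₀ R hR x hx y hy => ?_⟩
  have hT : Continuous fun y : EuclideanSpace ℝ (Fin n) => x₀ + R • y := continuous_const.add (continuous_id.const_smul R)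
  have hTC : ContDiff ℝ 1 fun y : EuclideanSpace ℝ (Fin n) => x₀ + R • y := contDiff_const.add (contDiff_id.const_smul R)
  have h := hH (fun y => a (x₀ + R • y)) (fun i j => (hmeas i j).comp hT.measurable) (fun y => hsymm _)
    (fun y ξ => hell _ ξ) (fun y i j => hbd _ i j) (fun y => w (x₀ + R • y)) (hw.comp hTC) (fun y => hw1 _)
    (weak_comp_affine hw hweak x₀ hR.ne')
  -- pull back the two points
  have hmem : ∀ z ∈ closedBall x₀ R, R⁻¹ • (z - x₀) ∈ closedBall (0 : EuclideanSpace ℝ (Fin n)) 1 := by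
    intro z hz
    rw [mem_closedBall, dist_zero_right, norm_smul, norm_inv, Real.norm_eq_abs, abs_of_pos hR]
    rw [mem_closedBall, dist_eq_norm] at hz
    calc R⁻¹ * ‖z - x₀‖ ≤ R⁻¹ * R := mul_le_mul_of_nonneg_left hz (inv_nonneg.2 hR.le)
      _ = 1 := inv_mul_cancel₀ hR.ne'
  have hback : ∀ z, x₀ + R • (R⁻¹ • (z - x₀)) = z := fun z => by
    rw [smul_smul, mul_inv_cancel₀ hR.ne', one_smul, add_sub_cancel]
  have h' := h _ (hmem x hx) _ (hmem y hy)
  simp only [hback] at h'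
  exact h'

/-! ### The Liouville theorem, `n ≥ 3` -/

/-- **LIOUVILLE THEOREM for `div(a∇u) = 0`, `n ≥ 3`** (Moser 1961, corollary of Thm 1; Jost, *PDE*, Thm 14.2.3): a bounded
entire `C¹` weak solution is constant.  (Proof: Harnack for `w_ε = (u − inf u + ε)/ε ≥ 1` on `B̄(0,R)`, `R → ∞`, `ε → 0`.) -/
theorem liouville_of_three_le (hn : 3 ≤ n) (a : EuclideanSpace ℝ (Fin n) → Matrix (Fin n) (Fin n) ℝ) (lam Λ : ℝ)
    (hlam : 0 < lam) (hmeas : ∀ i j, Measurable fun y => a y i j) (hsymm : ∀ y, (a y).IsSymm)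
    (hell : ∀ y (ξ : Fin n → ℝ), lam * (ξ ⬝ᵥ ξ) ≤ ξ ⬝ᵥ (a y *ᵥ ξ)) (hbd : ∀ y i j, |a y i j| ≤ Λ)
    (u : EuclideanSpace ℝ (Fin n) → ℝ) (hu : ContDiff ℝ 1 u) (hK : ∃ K : ℝ, ∀ y, |u y| ≤ K)
    (hweak : ∀ η : EuclideanSpace ℝ (Fin n) → ℝ, ContDiff ℝ 1 η → HasCompactSupport η →
      ∫ y, ∑ i, ∑ j, a y i j * fderiv ℝ u y (EuclideanSpace.single i 1) *
        fderiv ℝ η y (EuclideanSpace.single j 1) = 0) (x y : EuclideanSpace ℝ (Fin n)) :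
    u x = u y := by
  obtain ⟨C_H, hC0, hH⟩ := harnack_ball hn hlam Λ
  obtain ⟨K, hK⟩ := hK
  have hbdd : BddBelow (range u) := ⟨-K, by rintro _ ⟨z, rfl⟩; exact neg_le_of_abs_le (hK z)⟩
  set m : ℝ := ⨅ z, u z with hm
  have hmle : ∀ z, m ≤ u z := fun z => ciInf_le hbdd z
  -- every value equals the infimum
  suffices key : ∀ z, u z ≤ m by
    exact le_antisymm ((key x).trans (hmle y)) ((key y).trans (hmle x))
  intro z
  by_contra hzm
  rw [not_le] at hzm
  set c : ℝ := u z - m with hc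
  have hcpos : 0 < c := by rw [hc]; linarith
  -- ε = δ = c / (4 (C_H + 1))
  set ε : ℝ := c / (4 * (C_H + 1)) with hε
  have hεpos : 0 < ε := by rw [hε]; positivity
  obtain ⟨z', hz'⟩ : ∃ z', u z' < m + ε := exists_lt_of_ciInf_lt (by rw [← hm]; linarith)
  -- the normalised solution `w = (u - m + ε)/ε ≥ 1`
  set w : EuclideanSpace ℝ (Fin n) → ℝ := fun y => ε⁻¹ * (u y - m + ε) with hw
  have hw1 : ∀ y, 1 ≤ w y := fun y => by
    rw [hw]
    have := hmle y
    rw [le_inv_mul_iff₀' hεpos]; linarith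
  have hwC : ContDiff ℝ 1 w := contDiff_const.mul ((hu.sub contDiff_const).add contDiff_const)
  have hdw : ∀ y v, fderiv ℝ w y v = ε⁻¹ * fderiv ℝ u y v := by
    intro y v
    have hud : DifferentiableAt ℝ u y := (hu.differentiable one_ne_zero) y
    have h1 : fderiv ℝ w y = ε⁻¹ • fderiv ℝ u y := by
      rw [hw, fderiv_const_mul ((hud.sub_const m).add_const ε)]
      rw [fderiv_add_const, fderiv_sub_const]
    rw [h1]; rfl
  have hweak' : ∀ η : EuclideanSpace ℝ (Fin n) → ℝ, ContDiff ℝ 1 η → HasCompactSupport η →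
      ∫ y, ∑ i, ∑ j, a y i j * fderiv ℝ w y (EuclideanSpace.single i 1) *
        fderiv ℝ η y (EuclideanSpace.single j 1) = 0 := by
    intro η hη hηc
    have hpt : ∀ y, ∑ i, ∑ j, a y i j * fderiv ℝ w y (EuclideanSpace.single i 1) *
        fderiv ℝ η y (EuclideanSpace.single j 1) = ε⁻¹ * ∑ i, ∑ j, a y i j * fderiv ℝ u y (EuclideanSpace.single i 1) *
        fderiv ℝ η y (EuclideanSpace.single j 1) := by
      intro y
      simp only [hdw, Finset.mul_sum]
      exact Finset.sum_congr rfl fun i _ => Finset.sum_congr rfl fun j _ => by ring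
    simp_rw [hpt]
    rw [integral_const_mul, hweak η hη hηc, mul_zero]
  -- Harnack on a ball containing `z` and `z'`
  set R : ℝ := max ‖z‖ ‖z'‖ + 1 with hR
  have hRpos : 0 < R := by rw [hR]; positivity
  have hzR : z ∈ closedBall (0 : EuclideanSpace ℝ (Fin n)) R := by
    rw [mem_closedBall, dist_zero_right, hR]; linarith [le_max_left ‖z‖ ‖z'‖]
  have hz'R : z' ∈ closedBall (0 : EuclideanSpace ℝ (Fin n)) R := by
    rw [mem_closedBall, dist_zero_right, hR]; linarith [le_max_right ‖z‖ ‖z'‖]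
  have hHz := hH a hmeas hsymm hell hbd w hwC hw1 hweak' 0 R hRpos z hzR z' hz'R
  -- unpack: `u z - m + ε ≤ C_H (u z' - m + ε) < C_H · 2ε`, contradiction with `c = u z - m = 4(C_H+1)ε`
  simp only [hw] at hHz
  have h1 : u z - m + ε ≤ C_H * (u z' - m + ε) := by
    have := mul_le_mul_of_nonneg_left hHz hεpos.le
    have e1 : ε * (ε⁻¹ * (u z - m + ε)) = u z - m + ε := by field_simp
    have e2 : ε * (C_H * (ε⁻¹ * (u z' - m + ε))) = C_H * (u z' - m + ε) := by field_simp
    rwa [e1, e2] at this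
  have h2 : u z' - m + ε < 2 * ε := by linarith
  have h3 : C_H * (u z' - m + ε) ≤ C_H * (2 * ε) := mul_le_mul_of_nonneg_left h2.le hC0
  have h4 : c = 4 * (C_H + 1) * ε := by rw [hε]; field_simp
  nlinarith

end Summit.NavierStokesRegularity.NavierStokesRegularity.Theorems.PoloidalWindowDoorPoloidalWindowRigidityDivFormLiouvilleHigh

end
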